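import Summits.HodgeConjecture.HodgeConjecture.Theorems.Ring2WeilCoveragePfaffianForm
import Summits.HodgeConjecture.HodgeConjecture.Theorems.Ring2WeilCoverageSplitFibre
import Summits.HodgeConjecture.HodgeConjecture.Theorems.Ring2AbelianAllWeilSignature
import Summits.HodgeConjecture.HodgeConjecture.Theorems.Ring2AbelianAllWeilSimilarCells
import HarnessLib

/-!
# Ring 2 · Weil-type family-coverage census (ring2-b04, gen 41) — Pfaffian form of `det H`, part 3:
  ON THE CARRIERS — the cell of `(A, φ, h_K)` is read off ANY rational `K`-frame with square Gram determinant

research route conditional on HC_CM; not a corollary; Q11.4-sentence-2 already refuted in dim ≥ 3.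
`HC_CM` (`Theses.RankFourFaces.CMAbelianHodge`, by name) does not occur in this file; no case of the Hodge
conjecture is claimed. Cell `pub-hodge-ring2`, seat `ring2-b04` (gen 41), census file `WEIL-FAMILY-COVERAGE.md`
§b04.5 (PLACEMENT LAW). Parts 1–2: `Ring2WeilCoveragePfaffianForm` (the identity `det [[b, a], [-a, d b]] =
(det Ψ)²`), `Ring2WeilCoveragePfaffianFormDichotomies` (field-by-field classes).

Here the matrix statements are moved onto van Geemen's REAL CARRIERS (`(A, φ)` of Weil type `(n, d)`,
`HodgeTheory.IsWeilType`; the `K`-symmetrised hyperplane class `h_K = d·e^*a + φ^*e^*a`; a rational `K`-frame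
`x₁, …, x_{2n} ∈ H¹(A(ℂ); ℂ)` with `{xᵢ, φ^*xᵢ}` independent; Gram data `Q_{h_K}(xᵢ, φ^*xⱼ) = aᵢⱼ ω`,
`Q_{h_K}(xᵢ, xⱼ) = bᵢⱼ ω`, `det(a + b√-d) = q ∈ ℚˣ` — exactly a `HasWeilDiscriminantNondeg` witness):

* `gram_isSymm_of_frame`, `gram_transpose_eq_neg_of_frame` — the Gram data of ANY such frame are Hermitian:
  `a` is symmetric, `b` antisymmetric (cup-product alternation `polarizationPairingOne_swap` and the adjunction
  `Ring2.AbelianAll.polarizationPairingOne_ksymm_map_left`, both tree theorems) — so parts 1–2 apply with no extra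
  hypothesis;
* `mk_det_eq_mk_neg_one_pow_mul_of_frame` — **if the rational Gram matrix `[[b, a], [-a, d b]]` of the frame has
  square determinant `c²` (`c > 0`), then `[q] = [(-1)ⁿ c]`** — the sign `(-1)ⁿ q > 0` is SUPPLIED by the tree's
  Lemma 5.2 (4) (`Ring2.AbelianAll.weilSign_eq_of_hasWeilDiscriminantNondeg`), not assumed;
* `class_eq_mk_neg_one_pow_mul_of_frame` — **the CELL of `(A, φ, h_K)`: every non-degenerate discriminant class
  `δ` of `h_K` equals `[(-1)ⁿ c]`** (`det H` is well defined: `VanGeemen1994.hasWeilDiscriminantNondeg_ksymm_unique`);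
  `class_eq_split_iff_of_frame` — it is the split class iff `c ∈ Nm(K_dˣ)`; `class_eq_split_of_frame_two_pow_one` /
  `…_two` — over `ℚ(i)` / `ℚ(√-2)` a frame with Gram determinant `4ᵏ` puts `(A, φ, h_K)` in the SPLIT cell.

Census reading (b04.5): an INTEGRAL `ℤ[√-d]`-frame of a special fibre has Gram determinant
`([Λ:Λ₀]·d₁⋯d_{2n})²`; this file is the step «square Gram determinant of one frame ⟹ the cell», in the kernel.
Sorry-free; axioms standard; no `def`, no named fact.

## References

* [vanGeemen1994HodgeAV] B. van Geemen, LNM 1594 (1994), Lemma 5.2 (1)–(4), 5.4 and (5.4.1).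
* [Deligne1982HodgeCycles] P. Deligne, LNM 900 (1982), proof of Thm. 4.8 (the frame `(x, φ^*x)`).
-/

noncomputable section

set_option linter.dupNamespace false

open CategoryTheory Matrix
open Literature.AlgebraicGeometry Literature.AlgebraicGeometry.Motives
open Literature.AlgebraicGeometry.HodgeTheory
open Literature.AlgebraicGeometry.VanGeemen1994
open Literature.AlgebraicTopology.SingularHomology
open Summit.HodgeConjecture.HodgeConjecture.Ring2.Hypotheses
open Summit.HodgeConjecture.HodgeConjecture.Ring2.AbelianAll

namespace Summit.HodgeConjecture.HodgeConjecture.Ring2.WeilCoverage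

section Frame

variable {A : AbelianVariety ℂ} {φ : A ⟶ A} {n d : ℕ}

/-- Scalars on the line spanned by a non-zero `ω` are unique: `r • ω = s • ω ⟹ r = s` for rational `r, s`.
[folklore] -/
theorem ratCast_eq_of_smul_eq {M : Type*} [AddCommGroup M] [Module ℂ M] {ω : M} (hω0 : ω ≠ 0) {r s : ℚ}
    (h : ((r : ℚ) : ℂ) • ω = ((s : ℚ) : ℂ) • ω) : r = s := by
  have h' : ((r : ℂ) - (s : ℂ)) • ω = 0 := by rw [sub_smul, h, sub_self]
  rcases smul_eq_zero.1 h' with h1 | h1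
  · exact_mod_cast sub_eq_zero.1 h1
  · exact absurd h1 hω0

/-- **The Gram datum `a` of a `K`-frame is symmetric**: `Q_{h_K}(xⱼ, φ^*xᵢ) = Q_{h_K}(xᵢ, φ^*xⱼ)` by alternation
of the degree-one polarization pairing and the adjunction `Q_{h_K}(φ^*u, v) = -Q_{h_K}(u, φ^*v)`.
research route conditional on HC_CM; not a corollary; Q11.4-sentence-2 already refuted in dim ≥ 3.
[cite: vanGeemen1994HodgeAV, Lemma 5.2 (1)–(2)] -/
theorem gram_isSymm_of_frame (hW : IsWeilType A φ n d) (e : ProjectiveEmbedding A.X)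
    (a : complexBetti (projectiveSpace e.n ℂ) 2) {x : Fin (2 * n) → complexBetti A.X 1}
    {ω : complexBetti A.X (2 + 2 * (2 * n - 1))} {am bm : Matrix (Fin (2 * n)) (Fin (2 * n)) ℚ} (hω0 : ω ≠ 0)
    (hQ : ∀ i j, polarizationPairingOne A.X
          ((d : ℂ) • complexBetti.map e.ι 2 a + complexBetti.map φ.hom.hom.hom 2 (complexBetti.map e.ι 2 a))
          (2 * n - 1) (x i) (complexBetti.map φ.hom.hom.hom 1 (x j)) = ((am i j : ℚ) : ℂ) • ω ∧
        polarizationPairingOne A.X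
          ((d : ℂ) • complexBetti.map e.ι 2 a + complexBetti.map φ.hom.hom.hom 2 (complexBetti.map e.ι 2 a))
          (2 * n - 1) (x i) (x j) = ((bm i j : ℚ) : ℂ) • ω) :
    am.IsSymm := by
  have hA' : A.dim = 2 * n - 1 + 1 := by have := hW.pos; have := hW.dim_eq; omega
  refine Matrix.IsSymm.ext fun i j => ?_
  apply ratCast_eq_of_smul_eq hω0
  rw [← (hQ j i).1, ← (hQ i j).1, polarizationPairingOne_swap, polarizationPairingOne_ksymm_map_left hA' hW.d_pos
    hW.sq_eq e a (x i) (x j), neg_neg]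

/-- **The Gram datum `b` of a `K`-frame is antisymmetric** (`Q_{h_K}` is alternating on `H¹`).
research route conditional on HC_CM; not a corollary; Q11.4-sentence-2 already refuted in dim ≥ 3.
[cite: vanGeemen1994HodgeAV, Lemma 5.2 (1)–(2)] -/
theorem gram_transpose_eq_neg_of_frame (e : ProjectiveEmbedding A.X) (a : complexBetti (projectiveSpace e.n ℂ) 2)
    {x : Fin (2 * n) → complexBetti A.X 1} {ω : complexBetti A.X (2 + 2 * (2 * n - 1))}
    {am bm : Matrix (Fin (2 * n)) (Fin (2 * n)) ℚ} (hω0 : ω ≠ 0)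
    (hQ : ∀ i j, polarizationPairingOne A.X
          ((d : ℂ) • complexBetti.map e.ι 2 a + complexBetti.map φ.hom.hom.hom 2 (complexBetti.map e.ι 2 a))
          (2 * n - 1) (x i) (complexBetti.map φ.hom.hom.hom 1 (x j)) = ((am i j : ℚ) : ℂ) • ω ∧
        polarizationPairingOne A.X
          ((d : ℂ) • complexBetti.map e.ι 2 a + complexBetti.map φ.hom.hom.hom 2 (complexBetti.map e.ι 2 a))
          (2 * n - 1) (x i) (x j) = ((bm i j : ℚ) : ℂ) • ω) :
    bmᵀ = -bm := by
  ext i j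
  rw [transpose_apply, neg_apply]
  apply ratCast_eq_of_smul_eq hω0
  rw [← (hQ j i).2, polarizationPairingOne_swap, (hQ i j).2, Rat.cast_neg, neg_smul]

/-- **Carrier form of the Pfaffian law.** Let `(A, φ)` be of Weil type `(n, d)`, `h_K = d·e^*a + φ^*e^*a` a
`K`-symmetrised hyperplane class (`a ≠ 0` rational), and `(x, ω, am, bm, q)` a rational `K`-frame with its Gram data
and `det(am + bm√-d) = q ∈ ℚˣ`. If the rational Gram matrix `[[bm, am], [-am, d bm]]` of the `4n`-frame
`{xᵢ, φ^*xᵢ}` has SQUARE determinant `c²` (`c > 0`), then `[q] = [(-1)ⁿ c]` in `ℚˣ/Nm(K_dˣ)`. The Weil-type sign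
`(-1)ⁿ q > 0` comes from the tree's Lemma 5.2 (4).
research route conditional on HC_CM; not a corollary; Q11.4-sentence-2 already refuted in dim ≥ 3.
[cite: vanGeemen1994HodgeAV, Lemma 5.2 (3)–(4) and (5.4.1)] -/
theorem mk_det_eq_mk_neg_one_pow_mul_of_frame (hW : IsWeilType A φ n d) (e : ProjectiveEmbedding A.X)
    {a : complexBetti (projectiveSpace e.n ℂ) 2} (haQ : IsRationalClass a) (ha0 : a ≠ 0)
    (x : Fin (2 * n) → complexBetti A.X 1) (ω : complexBetti A.X (2 + 2 * (2 * n - 1)))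
    (am bm : Matrix (Fin (2 * n)) (Fin (2 * n)) ℚ) (q : ℚˣ) (hx : ∀ i, IsRationalClass (x i))
    (hind : LinearIndependent ℂ (Sum.elim x (fun i => complexBetti.map φ.hom.hom.hom 1 (x i))))
    (hω : IsRationalClass ω) (hω0 : ω ≠ 0)
    (hQ : ∀ i j, polarizationPairingOne A.X
          ((d : ℂ) • complexBetti.map e.ι 2 a + complexBetti.map φ.hom.hom.hom 2 (complexBetti.map e.ι 2 a))
          (2 * n - 1) (x i) (complexBetti.map φ.hom.hom.hom 1 (x j)) = ((am i j : ℚ) : ℂ) • ω ∧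
        polarizationPairingOne A.X
          ((d : ℂ) • complexBetti.map e.ι 2 a + complexBetti.map φ.hom.hom.hom 2 (complexBetti.map e.ι 2 a))
          (2 * n - 1) (x i) (x j) = ((bm i j : ℚ) : ℂ) • ω)
    (hdet : (weilGramMatrix d am bm).det = algebraMap ℚ (weilField d) (q : ℚ)) {c : ℚ} (hcpos : 0 < c)
    (hc : (weilStdGramMatrix n d am bm).det = c ^ 2) :
    (QuotientGroup.mk q : weilNormResidueGroup d) = QuotientGroup.mk ((-1 : ℚˣ) ^ n * Units.mk0 c hcpos.ne') := by
  have hδ : HasWeilDiscriminantNondeg A φ n d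
      ((d : ℂ) • complexBetti.map e.ι 2 a + complexBetti.map φ.hom.hom.hom 2 (complexBetti.map e.ι 2 a))
      (QuotientGroup.mk q) :=
    ⟨x, ω, am, bm, q, hx, hind, hω, hω0, hQ, hdet, rfl⟩
  have hsign : 0 < (-1 : ℚ) ^ n * q :=
    (weilSign_mk_eq_neg_one_pow_iff d q n).1 (weilSign_eq_of_hasWeilDiscriminantNondeg hW e haQ ha0 hδ)
  have hq0 : (q : ℚ) ≠ 0 := q.ne_zero
  have hmk : (QuotientGroup.mk q : weilNormResidueGroup d) = QuotientGroup.mk (Units.mk0 (q : ℚ) hq0) := by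
    congr 1; ext; rfl
  rw [hmk]
  exact mk_det_eq_mk_neg_one_pow_mul_of_sq hW.d_pos (gram_isSymm_of_frame hW e a hω0 hQ)
    (gram_transpose_eq_neg_of_frame e a hω0 hQ) hdet hc hcpos hsign hq0

/-- **The CELL of `(A, φ, h_K)` from one frame.** Under the hypotheses of `mk_det_eq_mk_neg_one_pow_mul_of_frame`:
every non-degenerate discriminant class `δ` of `h_K` (`HasWeilDiscriminantNondeg A φ n d h_K δ`) is `[(-1)ⁿ c]` —
`det H` is well defined on the carriers (`VanGeemen1994.hasWeilDiscriminantNondeg_ksymm_unique`, Lemma 5.2 (3)),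
so `(A, φ, h_K)` lies in the cell `(n, d, [(-1)ⁿ c])` and in no other.
research route conditional on HC_CM; not a corollary; Q11.4-sentence-2 already refuted in dim ≥ 3.
[cite: vanGeemen1994HodgeAV, Lemma 5.2 (3)–(4) and (5.4.1)] -/
theorem class_eq_mk_neg_one_pow_mul_of_frame (hW : IsWeilType A φ n d) (e : ProjectiveEmbedding A.X)
    {a : complexBetti (projectiveSpace e.n ℂ) 2} (haQ : IsRationalClass a) (ha0 : a ≠ 0)
    (x : Fin (2 * n) → complexBetti A.X 1) (ω : complexBetti A.X (2 + 2 * (2 * n - 1)))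
    (am bm : Matrix (Fin (2 * n)) (Fin (2 * n)) ℚ) (q : ℚˣ) (hx : ∀ i, IsRationalClass (x i))
    (hind : LinearIndependent ℂ (Sum.elim x (fun i => complexBetti.map φ.hom.hom.hom 1 (x i))))
    (hω : IsRationalClass ω) (hω0 : ω ≠ 0)
    (hQ : ∀ i j, polarizationPairingOne A.X
          ((d : ℂ) • complexBetti.map e.ι 2 a + complexBetti.map φ.hom.hom.hom 2 (complexBetti.map e.ι 2 a))
          (2 * n - 1) (x i) (complexBetti.map φ.hom.hom.hom 1 (x j)) = ((am i j : ℚ) : ℂ) • ω ∧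
        polarizationPairingOne A.X
          ((d : ℂ) • complexBetti.map e.ι 2 a + complexBetti.map φ.hom.hom.hom 2 (complexBetti.map e.ι 2 a))
          (2 * n - 1) (x i) (x j) = ((bm i j : ℚ) : ℂ) • ω)
    (hdet : (weilGramMatrix d am bm).det = algebraMap ℚ (weilField d) (q : ℚ)) {c : ℚ} (hcpos : 0 < c)
    (hc : (weilStdGramMatrix n d am bm).det = c ^ 2) {δ : weilNormResidueGroup d}
    (hδ : HasWeilDiscriminantNondeg A φ n d
      ((d : ℂ) • complexBetti.map e.ι 2 a + complexBetti.map φ.hom.hom.hom 2 (complexBetti.map e.ι 2 a)) δ) :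
    δ = QuotientGroup.mk ((-1 : ℚˣ) ^ n * Units.mk0 c hcpos.ne') := by
  have hδ' : HasWeilDiscriminantNondeg A φ n d
      ((d : ℂ) • complexBetti.map e.ι 2 a + complexBetti.map φ.hom.hom.hom 2 (complexBetti.map e.ι 2 a))
      (QuotientGroup.mk q) :=
    ⟨x, ω, am, bm, q, hx, hind, hω, hω0, hQ, hdet, rfl⟩
  rw [hasWeilDiscriminantNondeg_ksymm_unique hW.pos hW.dim_eq hW.d_pos hW.sq_eq e haQ hδ hδ']
  exact mk_det_eq_mk_neg_one_pow_mul_of_frame hW e haQ ha0 x ω am bm q hx hind hω hω0 hQ hdet hcpos hc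

/-- **Split test from one frame**: under the same hypotheses the cell of `(A, φ, h_K)` is the SPLIT cell
`(n, d, [(-1)ⁿ])` iff `c ∈ Nm(K_dˣ)` — for an integral `ℤ[√-d]`-frame of a special fibre, `c = [Λ:Λ₀]·d₁⋯d_{2n}`
(lattice index times polarization type; census b04.5).
research route conditional on HC_CM; not a corollary; Q11.4-sentence-2 already refuted in dim ≥ 3.
[cite: vanGeemen1994HodgeAV, 5.4 and (5.4.1)] -/
theorem class_eq_split_iff_of_frame (hW : IsWeilType A φ n d) (e : ProjectiveEmbedding A.X)
    {a : complexBetti (projectiveSpace e.n ℂ) 2} (haQ : IsRationalClass a) (ha0 : a ≠ 0)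
    (x : Fin (2 * n) → complexBetti A.X 1) (ω : complexBetti A.X (2 + 2 * (2 * n - 1)))
    (am bm : Matrix (Fin (2 * n)) (Fin (2 * n)) ℚ) (q : ℚˣ) (hx : ∀ i, IsRationalClass (x i))
    (hind : LinearIndependent ℂ (Sum.elim x (fun i => complexBetti.map φ.hom.hom.hom 1 (x i))))
    (hω : IsRationalClass ω) (hω0 : ω ≠ 0)
    (hQ : ∀ i j, polarizationPairingOne A.X
          ((d : ℂ) • complexBetti.map e.ι 2 a + complexBetti.map φ.hom.hom.hom 2 (complexBetti.map e.ι 2 a))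
          (2 * n - 1) (x i) (complexBetti.map φ.hom.hom.hom 1 (x j)) = ((am i j : ℚ) : ℂ) • ω ∧
        polarizationPairingOne A.X
          ((d : ℂ) • complexBetti.map e.ι 2 a + complexBetti.map φ.hom.hom.hom 2 (complexBetti.map e.ι 2 a))
          (2 * n - 1) (x i) (x j) = ((bm i j : ℚ) : ℂ) • ω)
    (hdet : (weilGramMatrix d am bm).det = algebraMap ℚ (weilField d) (q : ℚ)) {c : ℚ} (hcpos : 0 < c)
    (hc : (weilStdGramMatrix n d am bm).det = c ^ 2) {δ : weilNormResidueGroup d}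
    (hδ : HasWeilDiscriminantNondeg A φ n d
      ((d : ℂ) • complexBetti.map e.ι 2 a + complexBetti.map φ.hom.hom.hom 2 (complexBetti.map e.ι 2 a)) δ) :
    δ = splitDiscriminantClass n d ↔ Units.mk0 c hcpos.ne' ∈ normUnitsSubgroup ℚ (weilField d) := by
  rw [class_eq_mk_neg_one_pow_mul_of_frame hW e haQ ha0 x ω am bm q hx hind hω hω0 hQ hdet hcpos hc hδ,
    mk_neg_one_pow_mul_eq_splitDiscriminantClass_iff]

/-- **Over `ℚ(i)`: a frame with Gram determinant `4ᵏ` puts `(A, φ, h_K)` in the SPLIT cell** (`2 ∈ Nm(ℚ(i)ˣ)`);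
census b04.5: every `Q₈`-Prym over `ℚ(i)`.
research route conditional on HC_CM; not a corollary; Q11.4-sentence-2 already refuted in dim ≥ 3.
[cite: vanGeemen1994HodgeAV, 5.4 and (5.4.1)] -/
theorem class_eq_split_of_frame_two_pow_one {A : AbelianVariety ℂ} {φ : A ⟶ A} {n : ℕ} (hW : IsWeilType A φ n 1)
    (e : ProjectiveEmbedding A.X) {a : complexBetti (projectiveSpace e.n ℂ) 2} (haQ : IsRationalClass a)
    (ha0 : a ≠ 0) (x : Fin (2 * n) → complexBetti A.X 1) (ω : complexBetti A.X (2 + 2 * (2 * n - 1)))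
    (am bm : Matrix (Fin (2 * n)) (Fin (2 * n)) ℚ) (q : ℚˣ) (hx : ∀ i, IsRationalClass (x i))
    (hind : LinearIndependent ℂ (Sum.elim x (fun i => complexBetti.map φ.hom.hom.hom 1 (x i))))
    (hω : IsRationalClass ω) (hω0 : ω ≠ 0)
    (hQ : ∀ i j, polarizationPairingOne A.X
          (((1 : ℕ) : ℂ) • complexBetti.map e.ι 2 a + complexBetti.map φ.hom.hom.hom 2 (complexBetti.map e.ι 2 a))
          (2 * n - 1) (x i) (complexBetti.map φ.hom.hom.hom 1 (x j)) = ((am i j : ℚ) : ℂ) • ω ∧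
        polarizationPairingOne A.X
          (((1 : ℕ) : ℂ) • complexBetti.map e.ι 2 a + complexBetti.map φ.hom.hom.hom 2 (complexBetti.map e.ι 2 a))
          (2 * n - 1) (x i) (x j) = ((bm i j : ℚ) : ℂ) • ω)
    (hdet : (weilGramMatrix 1 am bm).det = algebraMap ℚ (weilField 1) (q : ℚ)) {k : ℕ}
    (hc : (weilStdGramMatrix n 1 am bm).det = ((2 : ℚ) ^ k) ^ 2) {δ : weilNormResidueGroup 1}
    (hδ : HasWeilDiscriminantNondeg A φ n 1
      (((1 : ℕ) : ℂ) • complexBetti.map e.ι 2 a + complexBetti.map φ.hom.hom.hom 2 (complexBetti.map e.ι 2 a)) δ) :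
    δ = splitDiscriminantClass n 1 :=
  (class_eq_split_iff_of_frame hW e haQ ha0 x ω am bm q hx hind hω hω0 hQ hdet (by positivity) hc hδ).2
    (two_pow_mem_normUnitsSubgroup_one k)

/-- **Over `ℚ(√-2)`: a frame with Gram determinant `4ᵏ` puts `(A, φ, h_K)` in the SPLIT cell** (`2 ∈ Nm(ℚ(√-2)ˣ)`);
census b04.5: every `Q₈`-Prym over `ℚ(√-2)` (`φ = i + j`).
research route conditional on HC_CM; not a corollary; Q11.4-sentence-2 already refuted in dim ≥ 3.
[cite: vanGeemen1994HodgeAV, 5.4 and (5.4.1)] -/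
theorem class_eq_split_of_frame_two_pow_two {A : AbelianVariety ℂ} {φ : A ⟶ A} {n : ℕ} (hW : IsWeilType A φ n 2)
    (e : ProjectiveEmbedding A.X) {a : complexBetti (projectiveSpace e.n ℂ) 2} (haQ : IsRationalClass a)
    (ha0 : a ≠ 0) (x : Fin (2 * n) → complexBetti A.X 1) (ω : complexBetti A.X (2 + 2 * (2 * n - 1)))
    (am bm : Matrix (Fin (2 * n)) (Fin (2 * n)) ℚ) (q : ℚˣ) (hx : ∀ i, IsRationalClass (x i))
    (hind : LinearIndependent ℂ (Sum.elim x (fun i => complexBetti.map φ.hom.hom.hom 1 (x i))))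
    (hω : IsRationalClass ω) (hω0 : ω ≠ 0)
    (hQ : ∀ i j, polarizationPairingOne A.X
          (((2 : ℕ) : ℂ) • complexBetti.map e.ι 2 a + complexBetti.map φ.hom.hom.hom 2 (complexBetti.map e.ι 2 a))
          (2 * n - 1) (x i) (complexBetti.map φ.hom.hom.hom 1 (x j)) = ((am i j : ℚ) : ℂ) • ω ∧
        polarizationPairingOne A.X
          (((2 : ℕ) : ℂ) • complexBetti.map e.ι 2 a + complexBetti.map φ.hom.hom.hom 2 (complexBetti.map e.ι 2 a))
          (2 * n - 1) (x i) (x j) = ((bm i j : ℚ) : ℂ) • ω)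
    (hdet : (weilGramMatrix 2 am bm).det = algebraMap ℚ (weilField 2) (q : ℚ)) {k : ℕ}
    (hc : (weilStdGramMatrix n 2 am bm).det = ((2 : ℚ) ^ k) ^ 2) {δ : weilNormResidueGroup 2}
    (hδ : HasWeilDiscriminantNondeg A φ n 2
      (((2 : ℕ) : ℂ) • complexBetti.map e.ι 2 a + complexBetti.map φ.hom.hom.hom 2 (complexBetti.map e.ι 2 a)) δ) :
    δ = splitDiscriminantClass n 2 :=
  (class_eq_split_iff_of_frame hW e haQ ha0 x ω am bm q hx hind hω hω0 hQ hdet (by positivity) hc hδ).2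
    (two_pow_mem_normUnitsSubgroup_two k)

end Frame

end Summit.HodgeConjecture.HodgeConjecture.Ring2.WeilCoverage

end
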